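import Summits.QuantumFields.BalabanUV.T4Continuum.Spine.NE4.GaussianBlockSpectrum
import Literature.Barriers.CriticalPhenomena.RigorousRGSmallParameterGaussianIBP

/-!
# Spine/NE4/GaussianBlockMeasure — (R57)(iii) THE MOMENT FUNCTIONAL IS THE GAUSSIAN INTEGRAL: (R57)'s algebraic `gaussE s` is the UNIQUE normalised linear
# functional on `ℝ[X]` with the Wick–Stein identity, and for `s = c²` it IS integration against Mathlib's Gaussian measure `gaussianReal 0 (c²)`

Cell `pub-balaban-gaps` (YM blitz G2), seat `ne4`, generation 16 (unit `pub-balaban-gaps-ne4-g16`); record `HOME/ne/NE4.md` §5 (R57)(iii).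

HONEST FRAMING.  NE4 = `T4CouplingMatching.ScaleShiftRate` is NOT IN PRINT ([Balaban1987RG1] = CMP **109** (1987) p. 264) and NOT proved.  This file removes the ONE
«formal» caveat of (R57) (`GaussianBlockSpectrum`: «for `0 ≤ s` it IS the Gaussian integral, a fact not used») — the identification of the algebraic moment functional with
the Gaussian measure — so that (R57)'s label «MODEL (kernel)» for the number `θ = L⁻²` rests on Mathlib's `ProbabilityTheory.gaussianReal`, not on a functional posited
by its moments.  Real analysis on polynomials (Stein's lemma = the tree's Gaussian integration by parts `GaussIBP.stein` in
`Literature/Barriers/CriticalPhenomena/RigorousRGSmallParameterGaussianIBP`); nothing of Bałaban's asserted; no status word moves (NE4 stays DEPENDENT; spine 0∕9).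
One finite T⁴; NOT ℝ⁴, NOT infinite volume, NOT a mass gap, NOT Clay.

CONTENT.
* §1 **UNIQUENESS** (pure algebra): a linear functional `E : ℝ[X] →ₗ[ℝ] ℝ` with `E 1 = 1` and the Wick–Stein identity `E (X·p) = s·E p′` for all `p` IS `gaussE s`
  (`eq_gaussE_of_stein` — normalisation + integration by parts determine every moment); and SCALING: `gaussE (c²) p = gaussE 1 (p.comp (C c * X))`
  (`gaussE_sq_eq_comp`, uniqueness applied to the rescaled functional).
* §2 polynomial growth of polynomial functions (`abs_eval_le_growth`: `|p(x)| ≤ (Σ_i |p_i|)·(1 + |x|)^{deg p}`), hence `N(0,1)`-integrability of `p.eval`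
  (`integrable_eval_gaussianReal`) and STEIN's identity for polynomials `∫ x·p(x) dN(0,1) = ∫ p′ dN(0,1)` (`integral_X_mul_eval`).
* §3 **THE GAUSSIAN INTEGRAL FUNCTIONAL** `gaussI p = ∫ p.eval dN(0,1)` is linear and normalised and satisfies the Wick–Stein identity with `s = 1`; so
  **`gaussE_one_eq_integral`**: `gaussE 1 p = ∫ x, p.eval x ∂(gaussianReal 0 1)`, and by the push-forward `gaussianReal_map_const_mul`
  **`gaussE_sq_eq_integral`**: `gaussE (c²) p = ∫ x, p.eval x ∂(gaussianReal 0 (c²))`.  Consequently (R57)'s `gaussE_He_affine` (Mehler), `gaussE_one_He_mul_He` (Wick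
  orthogonality) and `blockLin_He` are statements about genuine Gaussian expectations; in particular the block map is the Gaussian average it was named for:
  `blockLin vol a V x = vol · ∫ V(a·x + ζ) dN(0, 1 − a²)(ζ)` for `a² ≤ 1` (**`blockLin_eq_integral`**).

NOT PRINTED for lattice gauge theory (nothing here concerns it); the identities are [folklore]; NE4 NOT proved.
-/

noncomputable section

namespace Summit.QuantumFields.BalabanUV.T4Continuum.Spine.NE4

open Polynomial Finset MeasureTheory ProbabilityTheory
open Literature.Barriers.CriticalPhenomena.LongRangePhi4 (GaussIBP.stein GaussIBP.integrable_gaussianReal_of_abs_le)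
open scoped Nat NNReal

namespace GaussianBlock

/-! ## §1 Uniqueness of the normalised Wick–Stein functional; scaling -/

section Unique

/-- **UNIQUENESS**: a linear functional on `ℝ[X]` with `E 1 = 1` and the Wick–Stein identity `E (X·p) = s·E (p′)` is the moment functional `gaussE s` of (R57)
(two-step induction on monomials: `E(a X^{n+2}) = s·E((a X^{n+1})′)`; `E (a X) = s·E (a′) = 0`; `E a = a`). [folklore] -/
theorem eq_gaussE_of_stein {s : ℝ} {E : ℝ[X] →ₗ[ℝ] ℝ} (h1 : E 1 = 1) (hS : ∀ p : ℝ[X], E (X * p) = s * E (derivative p)) :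
    E = gaussE s := by
  have hmon : ∀ n (a : ℝ), E (monomial n a) = gaussE s (monomial n a) := by
    intro n
    induction n using Nat.twoStepInduction with
    | zero =>
      intro a
      rw [monomial_zero_left, gaussE_C, show C a = a • (1 : ℝ[X]) by rw [smul_eq_C_mul, mul_one], map_smul, h1, smul_eq_mul, mul_one]
    | one =>
      intro a
      have e : monomial 1 a = X * C a := by rw [mul_comm, C_mul_X_eq_monomial]
      rw [e, hS, derivative_C, map_zero, mul_zero, ← e, gaussE_monomial, gMoment_one, zero_mul]
    | more n h0 _ =>
      intro a
      rw [show n + 2 = n + 1 + 1 from rfl, ← X_mul_monomial, hS, gaussE_X_mul, derivative_monomial, Nat.add_sub_cancel, h0]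
  apply LinearMap.ext
  intro p
  induction p using Polynomial.induction_on' with
  | add p q hp hq => rw [map_add, map_add, hp, hq]
  | monomial n a => exact hmon n a

/-- [bookkeeping] Differentiating through the rescaling `ζ ↦ c·ζ`: `(p ∘ (cX))′ = c·(p′ ∘ (cX))`. [folklore] -/
theorem derivative_comp_C_mul_X (p : ℝ[X]) (c : ℝ) : derivative (p.comp (C c * X)) = C c * (derivative p).comp (C c * X) := by
  rw [derivative_comp, derivative_C_mul, derivative_X, mul_one]

/-- **SCALING**: `gaussE (c²) p = gaussE 1 (p.comp (C c * X))` — the centred Gaussian of variance `c²` is the image of the unit one under `ζ ↦ c·ζ`, here as an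
identity of moment functionals (uniqueness §1 applied to `p ↦ gaussE 1 (p ∘ (cX))`, whose Wick–Stein constant is `c·1·c`). [folklore] -/
theorem gaussE_sq_eq_comp (c : ℝ) (p : ℝ[X]) : gaussE (c ^ 2) p = gaussE 1 (p.comp (C c * X)) := by
  let E : ℝ[X] →ₗ[ℝ] ℝ :=
    { toFun := fun p => gaussE 1 (p.comp (C c * X))
      map_add' := fun p q => by simp only [add_comp, map_add]
      map_smul' := fun r p => by simp only [smul_comp, map_smul, smul_eq_mul, RingHom.id_apply] }
  have hE : E = gaussE (c ^ 2) := by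
    refine eq_gaussE_of_stein (by simp [E, gaussE_one]) fun q => ?_
    show gaussE 1 ((X * q).comp (C c * X)) = c ^ 2 * gaussE 1 ((derivative q).comp (C c * X))
    rw [mul_comp, X_comp, mul_assoc, gaussE_C_mul, gaussE_X_mul, one_mul, derivative_comp_C_mul_X, gaussE_C_mul]
    ring
  have := LinearMap.congr_fun hE p
  exact this.symm

end Unique

/-! ## §2 Polynomial growth, Gaussian integrability, Stein's identity for polynomials -/

section Growth

/-- THE COEFFICIENT SUM `Σ_{i ≤ deg p} |p_i|` (a growth constant for `p`). [folklore] -/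
def coeffAbsSum (p : ℝ[X]) : ℝ := ∑ i ∈ range (p.natDegree + 1), |p.coeff i|

/-- [bookkeeping] `0 ≤ coeffAbsSum p`. [folklore] -/
theorem coeffAbsSum_nonneg (p : ℝ[X]) : 0 ≤ coeffAbsSum p := sum_nonneg fun _ _ => abs_nonneg _

/-- **POLYNOMIAL GROWTH**: `|p(x)| ≤ (Σ_i |p_i|)·(1 + |x|)^{deg p}`. [folklore] -/
theorem abs_eval_le_growth (p : ℝ[X]) (x : ℝ) : |p.eval x| ≤ coeffAbsSum p * (1 + |x|) ^ p.natDegree := by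
  rw [eval_eq_sum_range, coeffAbsSum, sum_mul]
  refine (abs_sum_le_sum_abs _ _).trans (sum_le_sum fun i hi => ?_)
  rw [abs_mul, abs_pow]
  have hi' : i ≤ p.natDegree := Nat.lt_succ_iff.mp (mem_range.mp hi)
  have h1 : |x| ^ i ≤ (1 + |x|) ^ i := pow_le_pow_left₀ (abs_nonneg x) (by linarith [abs_nonneg x]) i
  have h2 : (1 + |x|) ^ i ≤ (1 + |x|) ^ p.natDegree := pow_le_pow_right₀ (by linarith [abs_nonneg x]) hi'
  exact mul_le_mul_of_nonneg_left (h1.trans h2) (abs_nonneg _)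

/-- [bookkeeping] The same bound with a larger constant and a larger exponent. [folklore] -/
theorem abs_eval_le_growth_of_le (p : ℝ[X]) {B : ℝ} {N : ℕ} (hB : coeffAbsSum p ≤ B) (hN : p.natDegree ≤ N) (x : ℝ) :
    |p.eval x| ≤ B * (1 + |x|) ^ N := by
  have hx : 1 ≤ 1 + |x| := by linarith [abs_nonneg x]
  calc |p.eval x| ≤ coeffAbsSum p * (1 + |x|) ^ p.natDegree := abs_eval_le_growth p x
    _ ≤ B * (1 + |x|) ^ N :=
        mul_le_mul hB (pow_le_pow_right₀ hx hN) (by positivity) ((coeffAbsSum_nonneg p).trans hB)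

/-- **GAUSSIAN INTEGRABILITY OF POLYNOMIALS**: `p.eval` is `N(0,1)`-integrable (the tree's `GaussIBP.integrable_gaussianReal_of_abs_le` + §2's growth). [folklore] -/
theorem integrable_eval_gaussianReal (p : ℝ[X]) : Integrable (fun x => p.eval x) (gaussianReal 0 1) :=
  GaussIBP.integrable_gaussianReal_of_abs_le p.continuous.aestronglyMeasurable (abs_eval_le_growth p)

/-- **STEIN's IDENTITY FOR POLYNOMIALS**: `∫ x·p(x) dN(0,1)(x) = ∫ p′(x) dN(0,1)(x)` — the tree's `GaussIBP.stein` (Gaussian integration by parts for C¹ functions of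
polynomial growth) fed with `Polynomial.hasDerivAt` and the growth bounds of `p`, `p′`. [folklore] -/
theorem integral_X_mul_eval (p : ℝ[X]) :
    ∫ x, (X * p).eval x ∂(gaussianReal 0 1) = ∫ x, (derivative p).eval x ∂(gaussianReal 0 1) := by
  simp only [eval_mul, eval_X]
  have hB1 : coeffAbsSum p ≤ coeffAbsSum p + coeffAbsSum (derivative p) := le_add_of_nonneg_right (coeffAbsSum_nonneg _)
  have hB2 : coeffAbsSum (derivative p) ≤ coeffAbsSum p + coeffAbsSum (derivative p) := le_add_of_nonneg_left (coeffAbsSum_nonneg _)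
  exact GaussIBP.stein (fun x => p.hasDerivAt x) (derivative p).continuous (abs_eval_le_growth_of_le p hB1 le_rfl)
    (abs_eval_le_growth_of_le (derivative p) hB2 ((natDegree_derivative_le p).trans (Nat.sub_le _ _)))

end Growth

/-! ## §3 The Gaussian integral functional; identification with `gaussE`; the block map as a Gaussian average -/

section Integral

/-- THE GAUSSIAN INTEGRAL FUNCTIONAL `p ↦ ∫ p dN(0,1)` as a linear map on `ℝ[X]`. [folklore] -/
def gaussI : ℝ[X] →ₗ[ℝ] ℝ where
  toFun p := ∫ x, p.eval x ∂(gaussianReal 0 1)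
  map_add' p q := by
    simp only [eval_add]
    exact integral_add (integrable_eval_gaussianReal p) (integrable_eval_gaussianReal q)
  map_smul' r p := by
    simp only [eval_smul, smul_eq_mul, RingHom.id_apply]
    exact integral_const_mul r _

/-- [bookkeeping] `gaussI p = ∫ p dN(0,1)`. [folklore] -/
theorem gaussI_apply (p : ℝ[X]) : gaussI p = ∫ x, p.eval x ∂(gaussianReal 0 1) := rfl

/-- [bookkeeping] Normalisation: `∫ 1 dN(0,1) = 1`. [folklore] -/
theorem gaussI_one : gaussI 1 = 1 := by
  simp [gaussI_apply]

/-- **THE MOMENT FUNCTIONAL IS THE GAUSSIAN INTEGRAL (unit variance)**: `gaussE 1 p = ∫ x, p.eval x ∂(gaussianReal 0 1)` for every polynomial `p` — §1's uniqueness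
applied to `gaussI` (normalised, Wick–Stein by `integral_X_mul_eval`). [folklore] -/
theorem gaussE_one_eq_integral (p : ℝ[X]) : gaussE 1 p = ∫ x, p.eval x ∂(gaussianReal 0 1) := by
  have h : gaussI = gaussE 1 := eq_gaussE_of_stein gaussI_one fun q => by rw [one_mul, gaussI_apply, gaussI_apply, integral_X_mul_eval]
  rw [← h, gaussI_apply]

/-- **THE MOMENT FUNCTIONAL IS THE GAUSSIAN INTEGRAL (variance `c²`)**: `gaussE (c²) p = ∫ x, p.eval x ∂(gaussianReal 0 (c²))` — scaling `gaussE_sq_eq_comp` + the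
push-forward `gaussianReal_map_const_mul` (`N(0,1)` under `x ↦ c·x` is `N(0,c²)`). [folklore] -/
theorem gaussE_sq_eq_integral (c : ℝ) (p : ℝ[X]) :
    gaussE (c ^ 2) p = ∫ x, p.eval x ∂(gaussianReal 0 (.mk (c ^ 2) (sq_nonneg c))) := by
  rw [gaussE_sq_eq_comp, gaussE_one_eq_integral]
  have hmap := gaussianReal_map_const_mul (μ := 0) (v := 1) c
  rw [mul_zero, mul_one] at hmap
  rw [← hmap, integral_map (by fun_prop) p.continuous.aestronglyMeasurable]
  simp only [eval_comp, eval_mul, eval_C, eval_X]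

/-- **THE BLOCK MAP IS THE GAUSSIAN AVERAGE IT WAS NAMED FOR**: for `a² ≤ 1`,
`blockLin vol a V x = vol · ∫ ζ, V(a·x + ζ) dN(0, 1 − a²)(ζ)` — (R57)'s `blockLin` (defined through `gaussE (1 − a²)`) against Mathlib's Gaussian measure. [folklore] -/
theorem blockLin_eq_integral (vol : ℝ) {a : ℝ} (ha : a ^ 2 ≤ 1) (V : ℝ[X]) (x : ℝ) :
    blockLin vol a V x = vol * ∫ ζ, V.eval (a * x + ζ) ∂(gaussianReal 0 (.mk (1 - a ^ 2) (sub_nonneg.2 ha))) := by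
  have hc : Real.sqrt (1 - a ^ 2) ^ 2 = 1 - a ^ 2 := Real.sq_sqrt (sub_nonneg.2 ha)
  have hnn : (NNReal.mk (1 - a ^ 2) (sub_nonneg.2 ha)) = .mk (Real.sqrt (1 - a ^ 2) ^ 2) (sq_nonneg _) := Subtype.ext hc.symm
  rw [hnn]
  conv_lhs => rw [blockLin, ← hc]
  rw [gaussE_sq_eq_integral]
  simp only [eval_comp, eval_add, eval_C, eval_X]

/-- **MEHLER's EIGENRELATION AS A GAUSSIAN INTEGRAL**: for `a² ≤ 1`, `∫ He_n(a·x + ζ) dN(0, 1 − a²)(ζ) = aⁿ·He_n(x)` — (R57)'s `gaussE_He_affine` transported. [folklore] -/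
theorem integral_He_affine {a : ℝ} (ha : a ^ 2 ≤ 1) (x : ℝ) (n : ℕ) :
    ∫ ζ, (He n).eval (a * x + ζ) ∂(gaussianReal 0 (.mk (1 - a ^ 2) (sub_nonneg.2 ha))) = a ^ n * (He n).eval x := by
  have h := blockLin_eq_integral 1 ha (He n) x
  rw [blockLin_He, one_mul, one_mul] at h
  exact h.symm

/-- **WICK ORTHOGONALITY AS A GAUSSIAN INTEGRAL**: `∫ He_n·He_m dN(0,1) = n!·δ_{nm}` — (R57)'s `gaussE_one_He_mul_He` transported: the `He n` are the orthogonal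
polynomials of Mathlib's standard Gaussian. [folklore] -/
theorem integral_He_mul_He (n m : ℕ) :
    ∫ x, (He n).eval x * (He m).eval x ∂(gaussianReal 0 1) = if n = m then (n ! : ℝ) else 0 := by
  rw [← gaussE_one_He_mul_He, gaussE_one_eq_integral]
  simp only [eval_mul]

end Integral

end GaussianBlock

end Summit.QuantumFields.BalabanUV.T4Continuum.Spine.NE4
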